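import Literature.Analysis.OperatorTheory.Enflo2023.RoomsSuffice
import HarnessLib

/-!
# Enflo (2023/24), Part B, p. 20 — the room claim WITH (46)'s constraint vector: it follows

Formalisation status: the p. 20 inference "(45) ∧ the side condition of (46) ⟹ room `≤ δ₂^40` ⟹ Cauchy
⟹ (11)" of P. H. Enflo, *On the invariant subspace problem in Hilbert spaces*, arXiv:2305.15442v2
(bib key `Enflo2023`), is part of a **claimed result under adjudication** in this library; nothing here
asserts the manuscript's theorem.  This file records what FOLLOWS, by an elementary Hilbert-space
identity, once the constraint vector of (46) is typed as printed — and thereby CORRECTS the reading under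
which the cell recorded Part B's "located gap" (`RoomClaim.lean`, `RoomClaimFin.lean`, `RoomClaimT.lean`).

## The correction

`RoomClaim ρ`, `RoomClaimFin`, `RoomClaimT` type the side condition
"ch⟨w₀₀, [ ]⁻¹_{n+1}x₀ − [ ]⁻¹_n x₀⟩ = 0" (v2 p. 20) with an ARBITRARY vector `w ≠ 0`, and are refuted by
models whose `w` is orthogonal to `x₀` and to the pivot.  The manuscript's `w₀₀` is not arbitrary:

* (46) [v2 p. 20]: `w₀₀ = y'_{n₀'} + δ₂^100 (T^{*j₁} + T^{*j₂}) y'_{n₀'}`, second term of norm `< 10⁻²⁰ δ₂^100 ‖y'‖`;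
* (40) [v2 p. 18]: `‖ V_y V_y^*[ ]⁻¹x₀ / ‖V_y V_y^*[ ]⁻¹x₀‖ − y/‖y‖ ‖ ≤ γ'((εθ))`, `γ'(εθ) → 0` as `(εθ) → 0`,
  where `V_y V_y^*[ ]⁻¹x₀ = x₀ − [ ]⁻¹x₀ = ℓ'(T)y'` is the ENDPOINT of the bracket, by (8);
* v1 (arXiv:2305.15442v1, p. 13) takes `w₀ = ℓ_{n'}(T) y_{n'}`, the pivot endpoint itself, exactly.

So the constraint vector is — exactly in v1, and up to an angle `g = γ'((εθ)_{n₀'}) + O(δ₂^100)` in v2 —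
the ENDPOINT OF THE PIVOT BRACKET `u_P := x₀ − v_P`, where `v_n := [ ]⁻¹_n x₀` and `P = n₀'` is the index
at which the constraint is imposed.

## The identity

With `(εθ)_n = ⟨v_n, x₀ − v_n⟩` ((15)–(16), hypothesis `hid`): `‖v_n‖² = Re⟨x₀, v_n⟩ − (εθ)_n`
(`norm_sq_eq_re_inner_sub`) — the bracket points lie on the sphere with diameter `[0, x₀]`, pushed inward
by `(εθ)_n`.  Hence, for `D := v_n − v_P` (`room_sq_identity`),
  `‖D‖² = Re⟨x₀, D⟩ + ((εθ)_P − (εθ)_n) − 2 Re⟨v_P, D⟩`,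
while (45) summed from the pivot with the ratio law `(εθ)_{k+1} ≤ (1−β)(εθ)_k` of (38) gives
  `|⟨x₀, D⟩| ≤ 10 ((εθ)_P − (εθ)_n)`  (`norm_inner_drift_le`; the printed "total change `< 10(εθ)₀`", p. 19),
and an exact side condition telescopes to `⟨c, D⟩ = 0` (`inner_sub_pivot_eq_zero`).  Therefore
* `c = x₀ − v_P` (v1; (46) up to the angle): `Re⟨v_P, D⟩ = Re⟨x₀, D⟩`, so
  `‖D‖² = ((εθ)_P − (εθ)_n) − Re⟨x₀, D⟩ ≤ 11 ((εθ)_P − (εθ)_n)`      (`room_sq_le_of_endpoint_constraint`);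
* `c = v_P`: `‖D‖² = ((εθ)_P − (εθ)_n) + Re⟨x₀, D⟩ ≤ 11 ((εθ)_P − (εθ)_n)`  (`room_sq_le_of_pivot_constraint`);
* `c` within angle `g` of `x₀ − v_P` (`‖ĉ − û_P‖ ≤ g`) and `‖x₀ − v_P‖ ≤ 1` (automatic, `norm_endpoint_le_one`):
  `‖D‖ ≤ 2 g + √(11 ((εθ)_P − (εθ)_n))`                                 (`room_le_of_near_endpoint_constraint`).
Geometrically: the constraint hyperplane through `v_P` orthogonal to `x₀ − v_P` (or to `v_P`) is TANGENT at
`v_P` to the sphere `‖v‖² − Re⟨x₀, v⟩ = const`; the refuting models of `RoomClaim.lean` &c. put the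
hyperplane through the axis `[0, x₀]` instead, where it confines nothing.  No path length enters: the
bounds depend on `(εθ)_P` only, not on the number of steps.

Consequently the printed room `δ₂^40` holds as soon as the pivot is taken with `11 (εθ)_{n₀'} ≤ δ₂^80`
(and `γ'` small) — the text's "in order to get (46) we can wait until `(εθ)_n` is arbitrarily small"
(v2 p. 20): `room_le_pow_of_wait`, and the packaged inferences `RoomClaim46 ρ` (exact) / `RoomClaim40 ρ`
(with the (40) angle), binder-for-binder `RoomClaim ρ` with `w := x₀ − v 0` resp. `w := c` near it plus
the wait hypothesis, are THEOREMS for every `ρ ≥ 0` (`roomClaim46_holds`, `roomClaim40_holds`) — whereas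
`not_roomClaim : ∀ ρ < 0.6, ¬ RoomClaim ρ`.  Re-imposing the constraint at pivots `p 0 < p 1 < …`
(p. 20: `w₀₀`, then `w₀₁` "when n is large enough", …) with `Σ_i (2 g_i + √(11 (εθ)_{p i})) < ∞` makes
`([ ]⁻¹_n x₀)` Cauchy (`cauchySeq_of_repivoting`), whence (11) and a non-trivial closed invariant subspace
by `hasNontrivialClosedInvariantSubspace_of_rooms`: `hasNontrivialClosedInvariantSubspace_of_repivoting`.

## What this does and does not settle

PROVED (sorry-free): the p. 20–21 inference "side condition + (45) ⟹ room ⟹ Cauchy ⟹ (11) ⟹ invariant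
subspace" for the constraint vector of (46)/(40)/v1, from (16), (45), the ratio form of (38), exactness of
the side condition, (9) and the norm window.  NOT addressed — and now the entire residual content of
Part B, none of it a located false inference: the EXISTENCE of Main-Construction steps satisfying the side
condition together with (34)–(45) at every step of every epoch (feasibility; (38)–(40) themselves; the
persistence of `ε`-independence, (33) ⇐ (27), which is Part A: `PolynomialIndependence.lean`, refuted AS
STATED in `LowerBound27Refutation.lean`), and the idealisation "first-order change `ch` = actual increment"
in the side condition and in (45).  `not_roomClaim`, `not_roomClaimFin`, `not_roomClaimT` remain correct
theorems about the `w`-arbitrary abstraction.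

Reading: `v n = [ ]⁻¹_n x₀` (as in `RoomClaim.lean`, `RoomsSuffice.lean`), `x₀ − v n = ℓ'_n(T) y'_n`;
Mathlib's `⟪a, b⟫_ℂ` is conjugate-linear in `a`, so the paper's `⟨a, b⟩` is `⟪b, a⟫_ℂ`.  All hypotheses
are invariant under `v ↦ x₀ − v`; in the endpoint reading the two exact cases are exchanged.
-/

open scoped InnerProductSpace
open Filter Topology RCLike Finset

namespace Literature.Analysis.OperatorTheory.Enflo2023

namespace PivotRoom

variable {H : Type*} [NormedAddCommGroup H] [InnerProductSpace ℂ H]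

/-! ### (1) The sphere identity (16), the summed drift (45), telescoping -/

/-- (15)–(16): `(εθ) = ⟨[ ]⁻¹x₀, x₀ − [ ]⁻¹x₀⟩` says `‖z‖² = Re⟨x₀, z⟩ − (εθ)` for `z = [ ]⁻¹x₀`: the bracket
points lie on the sphere with diameter `[0, x₀]`, pushed inward by `(εθ)`. [cite: Enflo2023, v2 p.5, (15)–(16)] -/
lemma norm_sq_eq_re_inner_sub {x₀ z : H} {ε : ℝ} (h : (ε : ℂ) = ⟪z, x₀ - z⟫_ℂ) :
    ‖z‖ ^ 2 = re ⟪x₀, z⟫_ℂ - ε := by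
  have h1 : re (ε : ℂ) = re ⟪z, x₀⟫_ℂ - re ⟪z, z⟫_ℂ := by rw [h, inner_sub_right, map_sub]
  have h2 : re (ε : ℂ) = ε := by simp
  rw [h2, inner_self_eq_norm_sq, inner_re_symm] at h1
  linarith

/-- The endpoint `x₀ − [ ]⁻¹x₀ = ℓ'(T)y'` has norm `≤ 1`: `‖x₀ − z‖² = 1 − ‖z‖² − 2(εθ)` by (16).
[cite: Enflo2023, v2 p.5, (15)–(16)] -/
lemma norm_endpoint_le_one {x₀ z : H} {ε : ℝ} (hx₀ : ‖x₀‖ = 1) (h : (ε : ℂ) = ⟪z, x₀ - z⟫_ℂ)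
    (hε : 0 ≤ ε) : ‖x₀ - z‖ ≤ 1 := by
  have h1 := norm_sq_eq_re_inner_sub h
  have h2 : ‖x₀ - z‖ ^ 2 = ‖x₀‖ ^ 2 - 2 * re ⟪x₀, z⟫_ℂ + ‖z‖ ^ 2 := norm_sub_sq (𝕜 := ℂ) _ _
  rw [hx₀] at h2
  have h3 : ‖x₀ - z‖ ^ 2 ≤ 1 := by nlinarith [norm_nonneg z]
  exact (pow_le_one_iff_of_nonneg (norm_nonneg _) two_ne_zero).mp h3

/-- (45) summed from a pivot `P`: `|⟨x₀, v_n − v_P⟩| ≤ 10 ((εθ)_P − (εθ)_n)` for `n ≥ P`, by one induction from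
the per-step bound `10 β (εθ)_k` and the ratio law `(εθ)_{k+1} ≤ (1 − β)(εθ)_k` ((38): a step consumes a
`β`-fraction of `(εθ)`).  This is the printed "total change `< 10 (εθ)₀`" with the telescoping made explicit;
no `β`-dependence survives. [cite: Enflo2023, v2 p.19, (45)] -/
lemma norm_inner_drift_le {x₀ : H} {v : ℕ → H} {εθ : ℕ → ℝ} {β : ℝ}
    (h45 : ∀ k, ‖⟪x₀, v (k + 1) - v k⟫_ℂ‖ ≤ 10 * β * εθ k)
    (hratio : ∀ k, εθ (k + 1) ≤ (1 - β) * εθ k) {P n : ℕ} (hPn : P ≤ n) :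
    ‖⟪x₀, v n - v P⟫_ℂ‖ ≤ 10 * (εθ P - εθ n) := by
  induction n, hPn using Nat.le_induction with
  | base => simp
  | succ n hPn ih =>
    have hsplit : v (n + 1) - v P = (v (n + 1) - v n) + (v n - v P) := by abel
    rw [hsplit, inner_add_right]
    calc ‖⟪x₀, v (n + 1) - v n⟫_ℂ + ⟪x₀, v n - v P⟫_ℂ‖
        ≤ ‖⟪x₀, v (n + 1) - v n⟫_ℂ‖ + ‖⟪x₀, v n - v P⟫_ℂ‖ := norm_add_le _ _
      _ ≤ 10 * β * εθ n + 10 * (εθ P - εθ n) := add_le_add (h45 n) ih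
      _ ≤ 10 * (εθ P - εθ (n + 1)) := by nlinarith [hratio n]

/-- An exact linear side condition on the steps telescopes: `⟨c, v_{k+1} − v_k⟩ = 0` for `P ≤ k < n` gives
`⟨c, v_n − v_P⟩ = 0`. [folklore] -/
lemma inner_sub_pivot_eq_zero {c : H} {v : ℕ → H} {P n : ℕ} (hPn : P ≤ n)
    (hc : ∀ k, P ≤ k → k < n → ⟪c, v (k + 1) - v k⟫_ℂ = 0) : ⟪c, v n - v P⟫_ℂ = 0 := by
  induction n, hPn using Nat.le_induction with
  | base => simp
  | succ n hPn ih =>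
    have hsplit : v (n + 1) - v P = (v (n + 1) - v n) + (v n - v P) := by abel
    rw [hsplit, inner_add_right, hc n hPn n.lt_succ_self,
      ih (fun k hk hkn => hc k hk (Nat.lt_succ_of_lt hkn)), add_zero]

/-! ### (2) The room identity and the three room bounds -/

/-- THE ROOM IDENTITY: from the sphere identity (16) at the pivot `P` and at `n`,
`‖v_n − v_P‖² = Re⟨x₀, v_n − v_P⟩ + ((εθ)_P − (εθ)_n) − 2 Re⟨v_P, v_n − v_P⟩`.
[cite: Enflo2023, v2 p.20, after (46)] -/
lemma room_sq_identity {x₀ : H} {v : ℕ → H} {εθ : ℕ → ℝ}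
    (hid : ∀ m, (εθ m : ℂ) = ⟪v m, x₀ - v m⟫_ℂ) (P n : ℕ) :
    ‖v n - v P‖ ^ 2
      = re ⟪x₀, v n - v P⟫_ℂ + (εθ P - εθ n) - 2 * re ⟪v P, v n - v P⟫_ℂ := by
  have hn := norm_sq_eq_re_inner_sub (hid n)
  have hP := norm_sq_eq_re_inner_sub (hid P)
  have h1 : ‖v n - v P‖ ^ 2 = ‖v n‖ ^ 2 - 2 * re ⟪v n, v P⟫_ℂ + ‖v P‖ ^ 2 :=
    norm_sub_sq (𝕜 := ℂ) _ _
  have h2 : re ⟪v P, v n - v P⟫_ℂ = re ⟪v n, v P⟫_ℂ - ‖v P‖ ^ 2 := by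
    rw [inner_sub_right, map_sub, inner_self_eq_norm_sq, inner_re_symm]
  have h3 : re ⟪x₀, v n - v P⟫_ℂ = re ⟪x₀, v n⟫_ℂ - re ⟪x₀, v P⟫_ℂ := by
    rw [inner_sub_right, map_sub]
  rw [h2, h3]; linarith

/-- ROOM FROM THE PIVOT-ENDPOINT CONSTRAINT (v1's `w₀ = ℓ_{n'}(T) y_{n'}`; (46) up to the (40) angle): with
(16), (45), the ratio law and `⟨x₀ − v_P, v_{k+1} − v_k⟩ = 0` on `[P, n)`,
`‖v_n − v_P‖² ≤ 11 ((εθ)_P − (εθ)_n)`. [cite: Enflo2023, v2 p.20, after (46); v1 p.13] -/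
theorem room_sq_le_of_endpoint_constraint {x₀ : H} {v : ℕ → H} {εθ : ℕ → ℝ} {β : ℝ}
    (hid : ∀ m, (εθ m : ℂ) = ⟪v m, x₀ - v m⟫_ℂ)
    (h45 : ∀ k, ‖⟪x₀, v (k + 1) - v k⟫_ℂ‖ ≤ 10 * β * εθ k)
    (hratio : ∀ k, εθ (k + 1) ≤ (1 - β) * εθ k) {P n : ℕ} (hPn : P ≤ n)
    (hc : ∀ k, P ≤ k → k < n → ⟪x₀ - v P, v (k + 1) - v k⟫_ℂ = 0) :
    ‖v n - v P‖ ^ 2 ≤ 11 * (εθ P - εθ n) := by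
  have hroom := room_sq_identity hid P n
  have hdrift := norm_inner_drift_le h45 hratio hPn
  have h0 : ⟪x₀ - v P, v n - v P⟫_ℂ = 0 := inner_sub_pivot_eq_zero hPn hc
  have h1 : re ⟪v P, v n - v P⟫_ℂ = re ⟪x₀, v n - v P⟫_ℂ - re ⟪x₀ - v P, v n - v P⟫_ℂ := by
    rw [← map_sub, ← inner_sub_left, sub_sub_cancel]
  rw [h1, h0, map_zero, sub_zero] at hroom
  have h2 := abs_re_le_norm ⟪x₀, v n - v P⟫_ℂ
  have h3 := neg_abs_le (re ⟪x₀, v n - v P⟫_ℂ)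
  linarith

/-- ROOM FROM THE PIVOT-POINT CONSTRAINT: the same bound when the constraint vector is the pivot bracket
point `v_P = [ ]⁻¹_P x₀` itself: `‖v_n − v_P‖² ≤ 11 ((εθ)_P − (εθ)_n)`. [cite: Enflo2023, v2 p.20, after (46)] -/
theorem room_sq_le_of_pivot_constraint {x₀ : H} {v : ℕ → H} {εθ : ℕ → ℝ} {β : ℝ}
    (hid : ∀ m, (εθ m : ℂ) = ⟪v m, x₀ - v m⟫_ℂ)
    (h45 : ∀ k, ‖⟪x₀, v (k + 1) - v k⟫_ℂ‖ ≤ 10 * β * εθ k)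
    (hratio : ∀ k, εθ (k + 1) ≤ (1 - β) * εθ k) {P n : ℕ} (hPn : P ≤ n)
    (hc : ∀ k, P ≤ k → k < n → ⟪v P, v (k + 1) - v k⟫_ℂ = 0) :
    ‖v n - v P‖ ^ 2 ≤ 11 * (εθ P - εθ n) := by
  have hroom := room_sq_identity hid P n
  have hdrift := norm_inner_drift_le h45 hratio hPn
  have h0 : ⟪v P, v n - v P⟫_ℂ = 0 := inner_sub_pivot_eq_zero hPn hc
  rw [h0, map_zero] at hroom
  have h2 := abs_re_le_norm ⟪x₀, v n - v P⟫_ℂ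
  have h3 := le_abs_self (re ⟪x₀, v n - v P⟫_ℂ)
  linarith

/-- `X² ≤ a + 2 g X` with `a, g ≥ 0` forces `X ≤ 2 g + √a`. [folklore] -/
lemma le_two_mul_add_sqrt {X a g : ℝ} (ha : 0 ≤ a) (hg : 0 ≤ g)
    (h : X ^ 2 ≤ a + 2 * g * X) : X ≤ 2 * g + Real.sqrt a := by
  by_contra hle
  have hlt := lt_of_not_ge hle
  have hs := Real.sqrt_nonneg a
  have hs2 := Real.sq_sqrt ha
  nlinarith [mul_pos (by linarith : (0 : ℝ) < X - 2 * g - Real.sqrt a)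
    (by linarith : (0 : ℝ) < X - 2 * g + Real.sqrt a),
    mul_nonneg hg (by linarith : (0 : ℝ) ≤ X - 2 * g)]

/-- ROOM FROM A CONSTRAINT VECTOR NEAR THE PIVOT ENDPOINT — (46) with the (40) angle.  `hang` says
`‖ĉ − û‖ ≤ g` for the unit vectors of `c` and `u = x₀ − v_P` (multiplied through by `‖c‖ ‖u‖`); with
`‖u‖ ≤ 1` the constraint transfers to `u` up to `g ‖v_n − v_P‖`, and `‖v_n − v_P‖ ≤ 2 g + √(11((εθ)_P − (εθ)_n))`.
No path length enters. [cite: Enflo2023, v2 p.18 (40), p.20 (46)] -/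
theorem room_le_of_near_endpoint_constraint {x₀ c : H} {v : ℕ → H} {εθ : ℕ → ℝ} {β g : ℝ}
    (hid : ∀ m, (εθ m : ℂ) = ⟪v m, x₀ - v m⟫_ℂ)
    (h45 : ∀ k, ‖⟪x₀, v (k + 1) - v k⟫_ℂ‖ ≤ 10 * β * εθ k)
    (hratio : ∀ k, εθ (k + 1) ≤ (1 - β) * εθ k) {P n : ℕ} (hPn : P ≤ n)
    (hc : ∀ k, P ≤ k → k < n → ⟪c, v (k + 1) - v k⟫_ℂ = 0) (hc0 : c ≠ 0) (hg : 0 ≤ g)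
    (hang : ‖((‖x₀ - v P‖ : ℝ) : ℂ) • c - ((‖c‖ : ℝ) : ℂ) • (x₀ - v P)‖ ≤ g * (‖c‖ * ‖x₀ - v P‖))
    (hu : ‖x₀ - v P‖ ≤ 1) (hεn : εθ n ≤ εθ P) :
    ‖v n - v P‖ ≤ 2 * g + Real.sqrt (11 * (εθ P - εθ n)) := by
  have hroom := room_sq_identity hid P n
  have hdrift := norm_inner_drift_le h45 hratio hPn
  have h0 : ⟪c, v n - v P⟫_ℂ = 0 := inner_sub_pivot_eq_zero hPn hc
  -- the angle hypothesis transfers the constraint to `u = x₀ - v P`, up to `g ‖u‖ ‖D‖`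
  have hkey : ‖⟪x₀ - v P, v n - v P⟫_ℂ‖ ≤ g * ‖x₀ - v P‖ * ‖v n - v P‖ := by
    have e1 : ⟪((‖x₀ - v P‖ : ℝ) : ℂ) • c - ((‖c‖ : ℝ) : ℂ) • (x₀ - v P), v n - v P⟫_ℂ
        = -(((‖c‖ : ℝ) : ℂ) * ⟪x₀ - v P, v n - v P⟫_ℂ) := by
      rw [inner_sub_left, inner_smul_left, inner_smul_left, h0, Complex.conj_ofReal,
        Complex.conj_ofReal]; ring
    have e2 := norm_inner_le_norm (𝕜 := ℂ) (((‖x₀ - v P‖ : ℝ) : ℂ) • c - ((‖c‖ : ℝ) : ℂ) • (x₀ - v P))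
      (v n - v P)
    rw [e1, norm_neg, norm_mul, Complex.norm_of_nonneg (norm_nonneg c)] at e2
    have e3 : ‖c‖ * ‖⟪x₀ - v P, v n - v P⟫_ℂ‖ ≤ ‖c‖ * (g * ‖x₀ - v P‖ * ‖v n - v P‖) := by
      calc ‖c‖ * ‖⟪x₀ - v P, v n - v P⟫_ℂ‖
          ≤ ‖((‖x₀ - v P‖ : ℝ) : ℂ) • c - ((‖c‖ : ℝ) : ℂ) • (x₀ - v P)‖ * ‖v n - v P‖ := e2
        _ ≤ g * (‖c‖ * ‖x₀ - v P‖) * ‖v n - v P‖ := by gcongr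
        _ = ‖c‖ * (g * ‖x₀ - v P‖ * ‖v n - v P‖) := by ring
    have hcpos : 0 < ‖c‖ := norm_pos_iff.mpr hc0
    exact le_of_mul_le_mul_left e3 hcpos
  have h1 : re ⟪v P, v n - v P⟫_ℂ = re ⟪x₀, v n - v P⟫_ℂ - re ⟪x₀ - v P, v n - v P⟫_ℂ := by
    rw [← map_sub, ← inner_sub_left, sub_sub_cancel]
  have hX : ‖v n - v P‖ ^ 2 ≤ 11 * (εθ P - εθ n) + 2 * g * ‖v n - v P‖ := by
    rw [h1] at hroom
    have a1 := abs_re_le_norm ⟪x₀, v n - v P⟫_ℂ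
    have a2 := abs_re_le_norm ⟪x₀ - v P, v n - v P⟫_ℂ
    have a3 := neg_abs_le (re ⟪x₀, v n - v P⟫_ℂ)
    have a4 := le_abs_self (re ⟪x₀ - v P, v n - v P⟫_ℂ)
    have a5 : g * ‖x₀ - v P‖ * ‖v n - v P‖ ≤ g * ‖v n - v P‖ := by
      have := mul_le_mul_of_nonneg_left hu hg
      have hD := norm_nonneg (v n - v P)
      nlinarith
    linarith
  exact le_two_mul_add_sqrt (by linarith) hg hX

/-- The printed numbers: with the pivot taken late enough that `11 (εθ)_{n₀'} ≤ δ₂^80` ("we can wait until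
`(εθ)_n` is arbitrarily small", v2 p.20) the room is `≤ δ₂^40`. [cite: Enflo2023, v2 p.20, "room < δ₂^40"] -/
theorem room_le_pow_of_wait {x₀ : H} {v : ℕ → H} {εθ : ℕ → ℝ} {β δ : ℝ}
    (hid : ∀ m, (εθ m : ℂ) = ⟪v m, x₀ - v m⟫_ℂ)
    (h45 : ∀ k, ‖⟪x₀, v (k + 1) - v k⟫_ℂ‖ ≤ 10 * β * εθ k)
    (hratio : ∀ k, εθ (k + 1) ≤ (1 - β) * εθ k) (hpos : ∀ n, 0 ≤ εθ n)
    (hc : ∀ k, ⟪x₀ - v 0, v (k + 1) - v k⟫_ℂ = 0) (hwait : 11 * εθ 0 ≤ δ ^ 80)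
    (n : ℕ) : ‖v n - v 0‖ ≤ δ ^ 40 := by
  have h := room_sq_le_of_endpoint_constraint hid h45 hratio (Nat.zero_le n) (fun k _ _ => hc k)
  have h80 : (δ ^ 40) ^ 2 = δ ^ 80 := by ring
  have h2 : ‖v n - v 0‖ ^ 2 ≤ (δ ^ 40) ^ 2 := by rw [h80]; linarith [hpos n]
  exact (sq_le_sq₀ (norm_nonneg _) (by positivity)).mp h2

/-! ### (3) Re-pivoting: epochs ⇒ rooms → 0 ⇒ Cauchy ⇒ (11) ⇒ invariant subspace -/

section Epochs

variable {E : Type*} [NormedAddCommGroup E]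

/-- Chaining epoch bounds between pivots `p i ≤ p j`. [folklore] -/
lemma norm_sub_le_sum_Ico {v : ℕ → E} {p : ℕ → ℕ} {r : ℕ → ℝ} (hp : StrictMono p)
    (hep : ∀ i n, p i ≤ n → n ≤ p (i + 1) → ‖v n - v (p i)‖ ≤ r i) {i j : ℕ} (hij : i ≤ j) :
    ‖v (p j) - v (p i)‖ ≤ ∑ m ∈ Ico i j, r m := by
  induction j, hij using Nat.le_induction with
  | base => simp
  | succ j hij ih =>
    have hsplit : v (p (j + 1)) - v (p i) = (v (p (j + 1)) - v (p j)) + (v (p j) - v (p i)) := by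
      abel
    rw [hsplit, sum_Ico_succ_top hij]
    calc ‖(v (p (j + 1)) - v (p j)) + (v (p j) - v (p i))‖
        ≤ ‖v (p (j + 1)) - v (p j)‖ + ‖v (p j) - v (p i)‖ := norm_add_le _ _
      _ ≤ r j + ∑ m ∈ Ico i j, r m :=
          add_le_add (hep j (p (j + 1)) (hp.monotone (Nat.le_succ j)) le_rfl) ih
      _ = ∑ m ∈ Ico i j, r m + r j := add_comm _ _

/-- Epoch bounds `r i` on `[p i, p (i+1)]` with `Σ r < ∞` give the rooms `Σ_{m ≥ i} r m` from every pivot. [folklore] -/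
lemma room_le_tsum_of_epochs {v : ℕ → E} {p : ℕ → ℕ} {r : ℕ → ℝ} (hp : StrictMono p)
    (hr : ∀ i, 0 ≤ r i) (hsum : Summable r)
    (hep : ∀ i n, p i ≤ n → n ≤ p (i + 1) → ‖v n - v (p i)‖ ≤ r i) {i n : ℕ} (hin : p i ≤ n) :
    ‖v n - v (p i)‖ ≤ ∑' m, r (m + i) := by
  -- locate the epoch of `n`: the least `j` with `n < p (j + 1)`
  have hex : ∃ j, n < p (j + 1) := ⟨n, hp.le_apply⟩
  obtain ⟨j, hj, hmin⟩ : ∃ j, n < p (j + 1) ∧ ∀ m, m < j → p (m + 1) ≤ n := by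
    classical
    exact ⟨Nat.find hex, Nat.find_spec hex, fun m hm => not_lt.mp (Nat.find_min hex hm)⟩
  have hpj : p j ≤ n := by
    cases j with
    | zero => exact (hp.monotone (Nat.zero_le i)).trans hin
    | succ m => exact hmin m m.lt_succ_self
  have hij : i ≤ j := by
    have : i < j + 1 := hp.lt_iff_lt.mp (lt_of_le_of_lt hin hj)
    omega
  calc ‖v n - v (p i)‖ = ‖(v n - v (p j)) + (v (p j) - v (p i))‖ := by abel_nf
    _ ≤ ‖v n - v (p j)‖ + ‖v (p j) - v (p i)‖ := norm_add_le _ _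
    _ ≤ r j + ∑ m ∈ Ico i j, r m := add_le_add (hep j n hpj hj.le) (norm_sub_le_sum_Ico hp hep hij)
    _ = ∑ m ∈ Ico i (j + 1), r m := by rw [sum_Ico_succ_top hij, add_comm]
    _ = ∑ k ∈ range (j + 1 - i), r (k + i) := by
        rw [sum_Ico_eq_sum_range]; exact sum_congr rfl fun k _ => by rw [add_comm]
    _ ≤ ∑' k, r (k + i) :=
        ((summable_nat_add_iff i).mpr hsum).sum_le_tsum _ (fun k _ => hr _)

/-- Epoch bounds with summable sizes make the sequence Cauchy (rooms `→ 0` from the pivots, then B14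
`cauchySeq_of_rooms`). [folklore] -/
theorem cauchySeq_of_epochs {v : ℕ → E} {p : ℕ → ℕ} {r : ℕ → ℝ} (hp : StrictMono p)
    (hr : ∀ i, 0 ≤ r i) (hsum : Summable r)
    (hep : ∀ i n, p i ≤ n → n ≤ p (i + 1) → ‖v n - v (p i)‖ ≤ r i) : CauchySeq v :=
  cauchySeq_of_rooms v p (fun i => ∑' m, r (m + i))
    (fun _ _ hin => room_le_tsum_of_epochs hp hr hsum hep hin) (tendsto_sum_nat_add r)

end Epochs

/-- ONE EPOCH OF THE RE-PIVOTED RUN: a constraint vector `c` within angle `g` of the pivot endpoint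
`x₀ − v_P`, imposed on `[P, Q)`, confines `v_n` for `P ≤ n ≤ Q` to the room `2 g + √(11 (εθ)_P)`.
[cite: Enflo2023, v2 p.20, (46) and after] -/
theorem epoch_room {x₀ c : H} {v : ℕ → H} {εθ : ℕ → ℝ} {β g : ℝ} (hx₀ : ‖x₀‖ = 1)
    (hid : ∀ m, (εθ m : ℂ) = ⟪v m, x₀ - v m⟫_ℂ) (hpos : ∀ n, 0 ≤ εθ n) (hanti : Antitone εθ)
    (h45 : ∀ k, ‖⟪x₀, v (k + 1) - v k⟫_ℂ‖ ≤ 10 * β * εθ k)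
    (hratio : ∀ k, εθ (k + 1) ≤ (1 - β) * εθ k) {P Q : ℕ} (hc0 : c ≠ 0) (hg : 0 ≤ g)
    (hang : ‖((‖x₀ - v P‖ : ℝ) : ℂ) • c - ((‖c‖ : ℝ) : ℂ) • (x₀ - v P)‖ ≤ g * (‖c‖ * ‖x₀ - v P‖))
    (hc : ∀ k, P ≤ k → k < Q → ⟪c, v (k + 1) - v k⟫_ℂ = 0) {n : ℕ} (hPn : P ≤ n) (hnQ : n ≤ Q) :
    ‖v n - v P‖ ≤ 2 * g + Real.sqrt (11 * εθ P) := by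
  have hu : ‖x₀ - v P‖ ≤ 1 := norm_endpoint_le_one hx₀ (hid P) (hpos P)
  have h := room_le_of_near_endpoint_constraint hid h45 hratio hPn
    (fun k hk hkn => hc k hk (lt_of_lt_of_le hkn hnQ)) hc0 hg hang hu (hanti hPn)
  have h2 : Real.sqrt (11 * (εθ P - εθ n)) ≤ Real.sqrt (11 * εθ P) :=
    Real.sqrt_le_sqrt (by linarith [hpos n])
  linarith

/-- RE-PIVOTING (p. 20: `w₀₀`, then `w₀₁` "when n is large enough", …): constraint vectors `c i` within angle
`g i` of the pivot endpoints `x₀ − v (p i)`, imposed on the epochs `[p i, p (i+1))`, with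
`Σ_i (2 g i + √(11 (εθ)_{p i})) < ∞`, make `([ ]⁻¹_n x₀)` a Cauchy sequence. [cite: Enflo2023, v2 p.20, after (46)] -/
theorem cauchySeq_of_repivoting {x₀ : H} {v : ℕ → H} {εθ : ℕ → ℝ} {β : ℝ} (hx₀ : ‖x₀‖ = 1)
    (hid : ∀ m, (εθ m : ℂ) = ⟪v m, x₀ - v m⟫_ℂ) (hpos : ∀ n, 0 ≤ εθ n) (hanti : Antitone εθ)
    (h45 : ∀ k, ‖⟪x₀, v (k + 1) - v k⟫_ℂ‖ ≤ 10 * β * εθ k)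
    (hratio : ∀ k, εθ (k + 1) ≤ (1 - β) * εθ k)
    {p : ℕ → ℕ} (hp : StrictMono p) {c : ℕ → H} {g : ℕ → ℝ} (hc0 : ∀ i, c i ≠ 0)
    (hg : ∀ i, 0 ≤ g i)
    (hang : ∀ i, ‖((‖x₀ - v (p i)‖ : ℝ) : ℂ) • c i - ((‖c i‖ : ℝ) : ℂ) • (x₀ - v (p i))‖
      ≤ g i * (‖c i‖ * ‖x₀ - v (p i)‖))
    (hc : ∀ i k, p i ≤ k → k < p (i + 1) → ⟪c i, v (k + 1) - v k⟫_ℂ = 0)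
    (hsum : Summable (fun i => 2 * g i + Real.sqrt (11 * εθ (p i)))) : CauchySeq v :=
  cauchySeq_of_epochs hp (fun i => add_nonneg (by linarith [hg i]) (Real.sqrt_nonneg _)) hsum
    (fun i _ hin hni => epoch_room hx₀ hid hpos hanti h45 hratio (hc0 i) (hg i) (hang i) (hc i) hin hni)

/-- PART B's TYPE-1 ENDGAME, CLOSED GIVEN THE RUN: `T`, `‖x₀‖ = 1`, a Main-Construction sequence of bracket
points `v n = [ ]⁻¹_n x₀` with the norm window, (9) with `(εθ)_n ↓ 0`, (16), (45), the ratio law of (38), and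
the (46)-type side conditions re-imposed at pivots `p i` with constraint vectors within summable angles
`g i` of the pivot endpoints ((40)) and `Σ √(11 (εθ)_{p i}) < ∞` (pivots taken late: "we can wait").  Then `T`
has a non-trivial closed invariant subspace — by the rooms, `cauchySeq_of_rooms`, (11), and
`hasNontrivialClosedInvariantSubspace_of_rooms`.  The unproved input is the EXISTENCE of such a run.
[cite: Enflo2023, v2 pp.20–21] -/
theorem hasNontrivialClosedInvariantSubspace_of_repivoting [CompleteSpace H] (T : H →L[ℂ] H)
    (x₀ : H) (hx₀ : ‖x₀‖ = 1) (v : ℕ → H) (εθ : ℕ → ℝ) (β : ℝ)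
    (hnorm : ∀ n, (0.3 : ℝ) ≤ ‖v n‖ ∧ ‖v n‖ ≤ 0.7)
    (h9 : ∀ n j, ‖⟪v n, (T ^ j) (x₀ - v n)⟫_ℂ‖ ≤ εθ n)
    (hid : ∀ m, (εθ m : ℂ) = ⟪v m, x₀ - v m⟫_ℂ) (hpos : ∀ n, 0 ≤ εθ n) (hanti : Antitone εθ)
    (hlim : Tendsto εθ atTop (𝓝 0))
    (h45 : ∀ k, ‖⟪x₀, v (k + 1) - v k⟫_ℂ‖ ≤ 10 * β * εθ k)
    (hratio : ∀ k, εθ (k + 1) ≤ (1 - β) * εθ k)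
    (p : ℕ → ℕ) (hp : StrictMono p) (c : ℕ → H) (g : ℕ → ℝ) (hc0 : ∀ i, c i ≠ 0)
    (hg : ∀ i, 0 ≤ g i)
    (hang : ∀ i, ‖((‖x₀ - v (p i)‖ : ℝ) : ℂ) • c i - ((‖c i‖ : ℝ) : ℂ) • (x₀ - v (p i))‖
      ≤ g i * (‖c i‖ * ‖x₀ - v (p i)‖))
    (hc : ∀ i k, p i ≤ k → k < p (i + 1) → ⟪c i, v (k + 1) - v k⟫_ℂ = 0)
    (hsum : Summable (fun i => 2 * g i + Real.sqrt (11 * εθ (p i)))) :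
    HasNontrivialClosedInvariantSubspace T :=
  hasNontrivialClosedInvariantSubspace_of_rooms T x₀ hx₀ v εθ hnorm h9 hlim p
    (fun i => ∑' m, (2 * g (m + i) + Real.sqrt (11 * εθ (p (m + i)))))
    (fun i _ hin => room_le_tsum_of_epochs (r := fun i => 2 * g i + Real.sqrt (11 * εθ (p i))) hp
      (fun i => add_nonneg (by linarith [hg i]) (Real.sqrt_nonneg _)) hsum
      (fun i _ hin hni => epoch_room hx₀ hid hpos hanti h45 hratio (hc0 i) (hg i) (hang i) (hc i) hin hni)
      hin)
    (tendsto_sum_nat_add (fun i => 2 * g i + Real.sqrt (11 * εθ (p i))))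

end PivotRoom

/-! ### (4) The p. 20 inference with (46)'s constraint vector, packaged like `RoomClaim` -/

/-- THE ROOM CLAIM OF p. 20 WITH THE CONSTRAINT VECTOR OF (46)/v1 (exact form `w₀₀ = x₀ − v 0`, the pivot
endpoint `ℓ'_{n₀'}(T) y'_{n₀'}`) and the printed WAIT `11 (εθ)_{n₀'} ≤ ρ²`: binder-for-binder `RoomClaim ρ`
with `w := x₀ − v 0` and the wait hypothesis added.  A THEOREM for every `ρ ≥ 0` (`roomClaim46_holds`);
contrast `not_roomClaim : ∀ ρ < 0.6, ¬ RoomClaim ρ`. [cite: Enflo2023, v2 p.20, (46) and after; v1 p.13] -/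
def RoomClaim46 (ρ : ℝ) : Prop :=
  ∀ (H : Type) [NormedAddCommGroup H] [InnerProductSpace ℂ H] [CompleteSpace H]
    (x₀ : H) (v : ℕ → H) (εθ : ℕ → ℝ) (β : ℝ),
    ‖x₀‖ = 1 → 0 < β → β < 1 →
    (∀ n, (0.3 : ℝ) ≤ re ⟪x₀, v n⟫_ℂ ∧ re ⟪x₀, v n⟫_ℂ ≤ 0.7) →
    (∀ n, (εθ n : ℂ) = ⟪v n, x₀ - v n⟫_ℂ) →
    (∀ n, 0 < εθ n) → StrictAnti εθ → Tendsto εθ atTop (𝓝 0) →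
    (∀ n, εθ (n + 1) ≤ (1 - β) * εθ n) →
    (∀ n, ‖⟪x₀, v (n + 1) - v n⟫_ℂ‖ ≤ 10 * β * εθ n) →
    (∀ n, ⟪x₀ - v 0, v (n + 1) - v n⟫_ℂ = 0) →
    11 * εθ 0 ≤ ρ ^ 2 →
    ∀ n, ‖v n - v 0‖ ≤ ρ

/-- `RoomClaim46 ρ` holds for every `ρ ≥ 0`. [cite: Enflo2023, v2 p.20, after (46)] -/
theorem roomClaim46_holds {ρ : ℝ} (hρ : 0 ≤ ρ) : RoomClaim46 ρ := by
  intro H _ _ _ x₀ v εθ β _ _ _ _ hid hpos _ _ hratio h45 hc hwait n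
  have h := PivotRoom.room_sq_le_of_endpoint_constraint hid h45 hratio (Nat.zero_le n)
    (fun k _ _ => hc k)
  have h2 : ‖v n - v 0‖ ^ 2 ≤ ρ ^ 2 := by linarith [hpos n]
  exact (sq_le_sq₀ (norm_nonneg _) hρ).mp h2

/-- THE ROOM CLAIM OF p. 20 WITH (46)'S CONSTRAINT VECTOR AT THE (40) ANGLE: `c ≠ 0` with
`‖ĉ − û‖ ≤ g`, `u = x₀ − v 0` the pivot endpoint, the side condition `⟨c, v_{k+1} − v_k⟩ = 0`, and the
wait `2 g + √(11 (εθ)_{n₀'}) ≤ ρ`; otherwise binder-for-binder `RoomClaim ρ`.  A THEOREM for every `ρ`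
(`roomClaim40_holds`). [cite: Enflo2023, v2 p.18 (40), p.20 (46)] -/
def RoomClaim40 (ρ : ℝ) : Prop :=
  ∀ (H : Type) [NormedAddCommGroup H] [InnerProductSpace ℂ H] [CompleteSpace H]
    (x₀ c : H) (v : ℕ → H) (εθ : ℕ → ℝ) (β g : ℝ),
    ‖x₀‖ = 1 → c ≠ 0 → 0 < β → β < 1 → 0 ≤ g →
    (∀ n, (0.3 : ℝ) ≤ re ⟪x₀, v n⟫_ℂ ∧ re ⟪x₀, v n⟫_ℂ ≤ 0.7) →
    (∀ n, (εθ n : ℂ) = ⟪v n, x₀ - v n⟫_ℂ) →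
    (∀ n, 0 < εθ n) → StrictAnti εθ → Tendsto εθ atTop (𝓝 0) →
    (∀ n, εθ (n + 1) ≤ (1 - β) * εθ n) →
    (∀ n, ‖⟪x₀, v (n + 1) - v n⟫_ℂ‖ ≤ 10 * β * εθ n) →
    ‖((‖x₀ - v 0‖ : ℝ) : ℂ) • c - ((‖c‖ : ℝ) : ℂ) • (x₀ - v 0)‖ ≤ g * (‖c‖ * ‖x₀ - v 0‖) →
    (∀ n, ⟪c, v (n + 1) - v n⟫_ℂ = 0) →
    2 * g + Real.sqrt (11 * εθ 0) ≤ ρ →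
    ∀ n, ‖v n - v 0‖ ≤ ρ

/-- `RoomClaim40 ρ` holds for every `ρ`. [cite: Enflo2023, v2 p.18 (40), p.20 (46)] -/
theorem roomClaim40_holds (ρ : ℝ) : RoomClaim40 ρ := by
  intro H _ _ _ x₀ c v εθ β g hx₀ hc0 _ _ hg _ hid hpos hanti _ hratio h45 hang hc hwait n
  have h := PivotRoom.epoch_room (Q := n) hx₀ hid (fun k => (hpos k).le) hanti.antitone h45 hratio
    hc0 hg hang (fun k _ _ => hc k) (Nat.zero_le n) le_rfl
  linarith

end Literature.Analysis.OperatorTheory.Enflo2023
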